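import Mathlib.Analysis.Complex.Polynomial.Basic
import Mathlib.LinearAlgebra.Eigenspace.Triangularizable
import Literature.NumberTheory.Automorphic.GKModules
import HarnessLib

/-!
# Proofs for `GKModules`: Dixmier–Schur; the Harish-Chandra module is a `(𝔤, K)`-module

This file discharges, sorry-free, two named facts of
`Literature/NumberTheory/Automorphic/GKModules.lean` (namespace `Literature.Automorphic`), for a linear
real group `G : RealMatrixGroup A N` with `K = G.maximalCompact`, `𝔤 = G.lie`, `𝔨 = G.compactLie`:

* `exists_hasInfinitesimalCharacter_of_irreducible_admissible G` — an irreducible admissible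
  `(𝔤, K)`-module `V` on which `Z(𝔤)` (the centre of the *real* enveloping algebra `U(𝔤)`,
  design D3 of `GKModules`) acts by `K`-equivariant operators has an infinitesimal character
  `θ : Z(𝔤) →ₐ[ℝ] ℂ`, i.e. every `z ∈ Z(𝔤)` acts by the scalar `θ z`
  (`exists_hasInfinitesimalCharacter_of_irreducible_admissible_holds`);
* `isGKModule_harishChandra G π` — for a strongly continuous representation `π` of `G` on a
  Banach space `H`, a subspace `V₀ ≤ H` which *is* the Harish-Chandra space `H_K^∞` of smooth
  `K`-finite vectors, with `K`-action `ρK` restricting `π|K` and `𝔤`-action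
  `ρ𝔤 X v = d/dt π (exp tX) v |_{t=0}` (`IsHarishChandraModuleOf`), satisfies the four
  `(𝔤, K)`-module axioms `IsGKModule G ρK ρ𝔤` (`isGKModule_harishChandra_holds`).

## The Dixmier–Schur lemma

Sources. Knapp–Vogan, *Cohomological Induction and Unitary Representations* (1995), §IV.7,
Prop. 4.87 (Dixmier: the `U(𝔤)`-linear endomorphisms of an irreducible `U(𝔤)`-module are the
scalars) and §IV.8 (a module *has an infinitesimal character* if `Z(𝔤)` acts by scalars; the
homomorphism `χ : Z(𝔤) → ℂ`); the remark after Prop. 4.117 (for `(𝔤, K)` in the Harish-Chandra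
class `Ad(k) z = z`, which is the rôle of the hypothesis `hZK` of the named fact).
Wallach, *Real Reductive Groups I* (1988), Lemma 3.3.2 (irreducible *admissible* `(𝔤, K)`-modules:
`Hom_{𝔤,K}(V, V) = ℂ`). Borel–Wallach, *Continuous Cohomology …* (2000), I.2.2 (an absolutely
irreducible admissible `(𝔤, 𝔨)`-module has an infinitesimal character `Z(𝔤) → F`).

Proof (the admissible route of Wallach, Lemma 3.3.2, which needs no countable-dimension
argument). Fix `z ∈ Z(𝔤)` and `T = ρ(z) ∈ End_ℂ V`.
1. `T` commutes with `ρ𝔤(X)` (`z` central, `commute_envelopingAction_center`) and with `ρK(k)`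
   (hypothesis), so every eigenspace `ker (T - c)` is a `(𝔤, K)`-submodule
   (`isGKSubmodule_eigenspace_envelopingAction`), hence `⊥` or `⊤` by irreducibility.
2. `T` has an eigenvalue: `V ≠ 0` and `K`-finiteness give a nonzero finite-dimensional
   `K`-stable subspace, which contains a minimal one `W₀` (`exists_minimal_stable_submodule`),
   an irreducible `K`-type `τ` (`isIrreducible_of_intertwiningMap_injective`, after transport to
   `Fin d → ℂ : Type` as `IsAdmissibleGK` quantifies over `W : Type`); by admissibility
   `Hom_K(τ, V)` is finite-dimensional, so `S = ∑_{f ∈ Hom_K(τ,V)} f(τ) ∋ W₀` is a nonzero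
   finite-dimensional `T`-stable subspace (`T ∘ f` is again an intertwiner), and `T|_S` has an
   eigenvalue over `ℂ` (`exists_hasEigenvalue_of_intertwiningMap`, Mathlib
   `Module.End.exists_eigenvalue`).
3. So `T = c(z) • 1`; `z ↦ c(z)` is an `ℝ`-algebra homomorphism because `ℂ → End_ℂ V` is
   injective (`V ≠ 0`).
Only the fields `IsGKModule.kFinite`, `IsIrreducibleGK`, `IsAdmissibleGK` and `hZK` are used.

## The Harish-Chandra module is a `(𝔤, K)`-module

Sources. Borel–Wallach, *Continuous Cohomology, Discrete Subgroups, and Representations of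
Reductive Groups*, Ch. 0, 2.6: "Let `(π, V) ∈ 𝒞_G`. Then `V₀` is a `(𝔤, K)`-module", where
`V₀ = V^∞ ∩ V_(K)` (Ch. 0, 2.4) and a `(𝔤, K)`-module is a `𝔤`-module which is a locally finite
`K`-module with 1) `π(k) π(X) v = π(Ad k (X)) π(k) v` and 2) on `K`-stable finite-dimensional
subspaces the representation of `K` is differentiable with differential `π|𝔨` (Ch. 0, 2.5).
Knapp–Vogan, *Cohomological Induction and Unitary Representations*, Introduction §1: "we call
`C^∞(V)_K` with its `U(𝔤)` and `K` structures the underlying `(𝔤, K)` module of `V`", the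
axioms being those of Ch. I §4, (1.86): (i) locally `K` finite (formally: `K` finite with `K`
acting continuously on `⟨π(K)v⟩`, (1.17)), (ii) the differentiated `K` action is the `𝔨` action,
(iii) `(Ad(k)u)x = k(u(k⁻¹x))`.  Wallach, *Real Reductive Groups I*, Lemma 3.3.3 with §3.3.4
(the cite carried by the fact itself).  In `IsGKModule` these are the four fields `kFinite`,
`weaklyContinuous` (= (i)/(1.17)), `ad_compat` (= (iii)/1)), `hasWeakDeriv` (= (ii)/2)).

The argument is elementary and is carried out axiom by axiom:

1. `kFinite` — `v ∈ H_K`, so the span of the `K`-orbit of `v` in `H` is finite-dimensional, and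
   the span of the `ρK`-orbit in `V₀` injects into it under the inclusion `V₀ ↪ H`;
2. `weaklyContinuous` — `k ↦ ρK k v` takes values in that finite-dimensional span `W`, on which
   every linear functional is continuous, and `k ↦ π k v` is continuous (strong continuity);
3. `ad_compat` — `π k (d/dt π (exp tX) π (k⁻¹) v) = d/dt π (k exp (tX) k⁻¹) v
   = d/dt π (exp (t Ad k X)) v` (`RealMatrixGroup.expMem_Ad`) and uniqueness of derivatives;
4. `hasWeakDeriv` — for `X ∈ 𝔨` the curve `t ↦ π (exp tX) v` lies in the closed
   (finite-dimensional) subspace `W`, hence so does its derivative `ρ𝔤 X v`; the derivative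
   transfers to the `W`-valued curve (the inclusion is isometric, `hasDerivAt_of_coe`) and then
   through the continuous functional `ℓ|W`.
Only strong continuity of `π`, `IsHarishChandraModuleOf` and the hypothesis `hρK` are used.

## Main results

* `Literature.NumberTheory.Automorphic.exists_minimal_stable_submodule`,
  `Literature.NumberTheory.Automorphic.isIrreducible_of_intertwiningMap_injective`,
  `Literature.NumberTheory.Automorphic.exists_hasEigenvalue_of_intertwiningMap` — representation-theoretic lemmas
  for a monoid `K` acting on a complex vector space (all proved).
* `Literature.NumberTheory.Automorphic.commute_envelopingAction_center`,
  `Literature.NumberTheory.Automorphic.isGKSubmodule_eigenspace_envelopingAction` (proved).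
* `Literature.NumberTheory.Automorphic.exists_hasInfinitesimalCharacter_of_irreducible_admissible_holds` (proved):
  the named fact `exists_hasInfinitesimalCharacter_of_irreducible_admissible G` holds.
* `Literature.NumberTheory.Automorphic.hasDerivAt_of_coe` — a curve in a subspace `p ≤ F`, differentiable in `F`
  with derivative in `p`, is differentiable in `p` (proved).
* `Literature.NumberTheory.Automorphic.isGKModule_harishChandra_holds` (proved): the named fact
  `isGKModule_harishChandra G π` holds.

## References

* A. W. Knapp, D. A. Vogan, *Cohomological Induction and Unitary Representations*, Princeton
  Math. Series 45, Princeton Univ. Press 1995 [KnappVogan1995]: Introduction §1; Ch. I, (1.17),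
  (1.64), (1.86); Prop. 4.87, §IV.7–IV.8, Prop. 4.117 and the remark following it.
* N. R. Wallach, *Real Reductive Groups I*, Academic Press 1988 [WallachRRG1]: §1.6, §3.3.1,
  Lemma 3.3.2, Lemma 3.3.3, §3.3.4.
* A. Borel, N. Wallach, *Continuous Cohomology, Discrete Subgroups, and Representations of
  Reductive Groups*, 2nd ed., Math. Surveys Monogr. 67, AMS 2000 [BorelWallach2000]: Ch. 0,
  2.4–2.6; I.2.2.
-/

-- Mathlib idiom (Mathlib/Algebra/Lie/OfAssociative.lean); needed to mention Lie subalgebras of matrix algebras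
attribute [local instance 100] LieRing.ofAssociativeRing

open scoped MatrixGroups Matrix

noncomputable section

namespace Literature.NumberTheory.Automorphic

section DixmierSchurAux

variable {K : Type*} [Monoid K] {V : Type*} [AddCommGroup V] [Module ℂ V]
  (ρ : Representation ℂ K V)

/-- A nonzero finite-dimensional `K`-stable subspace contains a nonzero `K`-stable subspace that is
minimal among nonzero `K`-stable subspaces (take one of least dimension).
Wallach, *Real Reductive Groups I*, §1.4.6 and §3.3.1. [folklore] -/
theorem exists_minimal_stable_submodule (F : Submodule ℂ V) [FiniteDimensional ℂ F]
    (hF : F ≠ ⊥) (hFK : ∀ k, ∀ w ∈ F, ρ k w ∈ F) :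
    ∃ W₀ : Submodule ℂ V, W₀ ≤ F ∧ W₀ ≠ ⊥ ∧ (∀ k, ∀ w ∈ W₀, ρ k w ∈ W₀) ∧
      ∀ U : Submodule ℂ V, (∀ k, ∀ u ∈ U, ρ k u ∈ U) → U ≤ W₀ → U = ⊥ ∨ U = W₀ := by
  classical
  let S : Set (Submodule ℂ V) := {W | W ≤ F ∧ W ≠ ⊥ ∧ ∀ k, ∀ w ∈ W, ρ k w ∈ W}
  have hFS : F ∈ S := ⟨le_rfl, hF, hFK⟩
  let f : Submodule ℂ V → ℕ := fun W => Module.finrank ℂ W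
  obtain ⟨W₀, hW₀⟩ : ∃ W₀ : Submodule ℂ V, Function.argminOn f S ⟨F, hFS⟩ = W₀ := ⟨_, rfl⟩
  obtain ⟨hW₀F, hW₀ne, hW₀K⟩ : W₀ ∈ S := hW₀ ▸ Function.argminOn_mem f S ⟨F, hFS⟩
  refine ⟨W₀, hW₀F, hW₀ne, hW₀K, fun U hUK hUle => ?_⟩
  rcases eq_or_ne U ⊥ with hU | hU
  · exact Or.inl hU
  · right
    have hUS : U ∈ S := ⟨hUle.trans hW₀F, hU, hUK⟩
    have hle : f W₀ ≤ f U := hW₀ ▸ Function.argminOn_le f S hUS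
    haveI : FiniteDimensional ℂ W₀ := Submodule.finiteDimensional_of_le hW₀F
    exact Submodule.eq_of_le_of_finrank_le hUle hle

/-- A representation `τ` admitting an injective intertwiner `j` into `ρ` whose image is a minimal
nonzero `K`-stable subspace is irreducible. Wallach, §1.4.6. [folklore] -/
theorem isIrreducible_of_intertwiningMap_injective {W : Type*} [AddCommGroup W] [Module ℂ W]
    [Nontrivial W] {τ : Representation ℂ K W} (j : τ.IntertwiningMap ρ)
    (hj : Function.Injective j)
    (hmin : ∀ U : Submodule ℂ V, (∀ k, ∀ u ∈ U, ρ k u ∈ U) →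
      U ≤ LinearMap.range j.toLinearMap → U = ⊥ ∨ U = LinearMap.range j.toLinearMap) :
    τ.IsIrreducible := by
  haveI : Nontrivial (Subrepresentation τ) :=
    ⟨⟨⊥, ⊤, fun h => bot_ne_top (congrArg Subrepresentation.toSubmodule h)⟩⟩
  have hj' : Function.Injective j.toLinearMap := fun a b h => hj h
  refine ⟨fun U => ?_⟩
  let U' : Submodule ℂ V := U.toSubmodule.map j.toLinearMap
  have hU'K : ∀ k, ∀ u ∈ U', ρ k u ∈ U' := by
    rintro k _ ⟨u, hu, rfl⟩
    exact ⟨τ k u, U.apply_mem_toSubmodule k hu, j.isIntertwining _ _ k u⟩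
  have hU'le : U' ≤ LinearMap.range j.toLinearMap := LinearMap.map_le_range
  rcases hmin U' hU'K hU'le with h | h
  · left
    apply Subrepresentation.toSubmodule_injective
    apply Submodule.map_injective_of_injective hj'
    change Submodule.map j.toLinearMap U.toSubmodule = Submodule.map j.toLinearMap ⊥
    rw [Submodule.map_bot]
    exact h
  · right
    apply Subrepresentation.toSubmodule_injective
    apply Submodule.map_injective_of_injective hj'
    change Submodule.map j.toLinearMap U.toSubmodule = Submodule.map j.toLinearMap ⊤
    rw [Submodule.map_top]
    exact h

/-- **Isotypic pieces are finite-dimensional under admissibility.** If `Hom_K(τ, ρ)` is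
finite-dimensional (`τ` finite-dimensional) and nonzero, then any `T ∈ End V` commuting with
`ρ(K)` has an eigenvalue: `T` preserves the finite-dimensional nonzero subspace
`∑_{f ∈ Hom_K(τ, ρ)} f(W)`. Wallach, §3.3.1–3.3.2. [folklore] -/
theorem exists_hasEigenvalue_of_intertwiningMap {W : Type*} [AddCommGroup W] [Module ℂ W]
    [FiniteDimensional ℂ W] {τ : Representation ℂ K W}
    [FiniteDimensional ℂ (τ.IntertwiningMap ρ)] (j : τ.IntertwiningMap ρ) (hj : j ≠ 0)
    (T : Module.End ℂ V) (hT : ∀ k, ρ k ∘ₗ T = T ∘ₗ ρ k) :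
    ∃ c : ℂ, T.HasEigenvalue c := by
  classical
  let b := Module.finBasis ℂ W
  let ev : Fin (Module.finrank ℂ W) → (τ.IntertwiningMap ρ →ₗ[ℂ] V) := fun i =>
    { toFun := fun f => f (b i)
      map_add' := fun f g => rfl
      map_smul' := fun c f => rfl }
  let S : Submodule ℂ V := ⨆ i, LinearMap.range (ev i)
  have Tpost : ∀ f : τ.IntertwiningMap ρ, ∃ g : τ.IntertwiningMap ρ, ∀ w, g w = T (f w) := by
    intro f
    refine ⟨⟨T ∘ₗ f.toLinearMap, fun k => ?_⟩, fun w => rfl⟩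
    rw [LinearMap.comp_assoc, f.isIntertwining' k, ← LinearMap.comp_assoc, ← hT k,
      LinearMap.comp_assoc]
  have hS : ∀ (f : τ.IntertwiningMap ρ) (w : W), f w ∈ S := by
    intro f w
    rw [← b.sum_repr w, map_sum]
    refine Submodule.sum_mem _ fun i _ => ?_
    rw [map_smul]
    exact Submodule.smul_mem _ _ (Submodule.mem_iSup_of_mem i ⟨f, rfl⟩)
  have hTS : ∀ s ∈ S, T s ∈ S := by
    intro s hs
    refine Submodule.iSup_induction _ (motive := fun s => T s ∈ S) hs (fun i s hs => ?_)
      (by simp) (fun x y hx hy => by simpa using S.add_mem hx hy)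
    obtain ⟨f, rfl⟩ := hs
    obtain ⟨g, hg⟩ := Tpost f
    change T (f (b i)) ∈ S
    rw [← hg]
    exact hS g (b i)
  obtain ⟨w, hw⟩ : ∃ w, j w ≠ 0 := by
    by_contra! h
    exact hj (Representation.IntertwiningMap.ext (LinearMap.ext h))
  haveI : Nontrivial S := ⟨⟨⟨j w, hS j w⟩, 0, fun h => hw (congrArg Subtype.val h)⟩⟩
  obtain ⟨c, hc⟩ := Module.End.exists_eigenvalue (T.restrict hTS)
  obtain ⟨s, hs⟩ := hc.exists_hasEigenvector
  have hs0 : s ≠ 0 := (Module.End.hasEigenvector_iff.mp hs).2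
  have hsV : (s : V) ∈ T.eigenspace c := by
    rw [Module.End.mem_eigenspace_iff]
    have := congrArg Subtype.val hs.apply_eq_smul
    simpa [LinearMap.restrict_apply] using this
  refine ⟨c, Module.End.hasEigenvalue_iff.mpr fun hbot => hs0 ?_⟩
  rw [hbot, Submodule.mem_bot] at hsV
  exact Subtype.ext hsV

end DixmierSchurAux

section DixmierSchur

variable {A : Type*} [NormedCommRing A] [NormedAlgebra ℝ A] [NormedAlgebra ℚ A] [CompleteSpace A]
  [StarRing A] {N : Type*} [Fintype N] [DecidableEq N] {G : RealMatrixGroup A N}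
  {V : Type*} [AddCommGroup V] [Module ℂ V]
  (ρK : Representation ℂ G.maximalCompact V) (ρ𝔤 : G.lie →ₗ⁅ℝ⁆ Module.End ℂ V)

/-- Central elements `z ∈ Z(𝔤)` act by operators commuting with `ρ𝔤(𝔤)` (`X z = z X` in `U(𝔤)`
for `X ∈ 𝔤`). Knapp–Vogan, §IV.7 (proof of Thm. 4.95); Wallach, §3.2. [folklore] -/
theorem commute_envelopingAction_center (z : centerU G) (X : G.lie) :
    ρ𝔤 X * envelopingAction ρ𝔤 (z : UniversalEnvelopingAlgebra ℝ G.lie) =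
      envelopingAction ρ𝔤 (z : UniversalEnvelopingAlgebra ℝ G.lie) * ρ𝔤 X := by
  have hz := Subalgebra.mem_center_iff.mp z.2 (UniversalEnvelopingAlgebra.ι ℝ X)
  have := congrArg (envelopingAction ρ𝔤) hz
  rwa [map_mul, map_mul, envelopingAction_ι] at this

/-- The eigenspaces of a central element `z ∈ Z(𝔤)` acting by a `K`-equivariant operator are
`(𝔤, K)`-submodules. Wallach, Lemma 3.3.2 (proof). [folklore] -/
theorem isGKSubmodule_eigenspace_envelopingAction (z : centerU G)
    (hZK : ∀ k : G.maximalCompact,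
      ρK k ∘ₗ envelopingAction ρ𝔤 (z : UniversalEnvelopingAlgebra ℝ G.lie) =
        envelopingAction ρ𝔤 (z : UniversalEnvelopingAlgebra ℝ G.lie) ∘ₗ ρK k) (c : ℂ) :
    IsGKSubmodule ρK ρ𝔤
      ((envelopingAction ρ𝔤 (z : UniversalEnvelopingAlgebra ℝ G.lie)).eigenspace c) := by
  refine ⟨fun k w hw => ?_, fun X w hw => ?_⟩
  · rw [Module.End.mem_eigenspace_iff] at hw ⊢
    have := LinearMap.congr_fun (hZK k) w
    simp only [LinearMap.coe_comp, Function.comp_apply] at this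
    rw [← this, hw, map_smul]
  · rw [Module.End.mem_eigenspace_iff] at hw ⊢
    have := LinearMap.congr_fun (commute_envelopingAction_center ρ𝔤 z X) w
    simp only [Module.End.mul_apply] at this
    rw [← this, hw, map_smul]

variable (G) in
/-- **Dixmier–Schur lemma for `(𝔤, K)`-modules** (discharge of the named fact
`exists_hasInfinitesimalCharacter_of_irreducible_admissible`): an irreducible admissible
`(𝔤, K)`-module on which `Z(𝔤)` acts by `K`-equivariant operators has an infinitesimal character
`θ : Z(𝔤) →ₐ[ℝ] ℂ`. Wallach, *Real Reductive Groups I*, Lemma 3.3.2; Knapp–Vogan, Prop. 4.87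
(Dixmier) with §IV.8 (definition of "has an infinitesimal character", the page of (4.114)) and the
remark after Prop. 4.117 (`Ad(k) z = z` in the Harish-Chandra class); Borel–Wallach, I.2.2.
Proof: for `z ∈ Z(𝔤)` the operator `T = ρ(z)` commutes with `ρ𝔤(𝔤)` (centrality) and with
`ρK(K)` (hypothesis), so its eigenspaces are `(𝔤, K)`-submodules; an eigenvalue exists because,
by `K`-finiteness, `V` contains an irreducible `K`-type `τ` and, by admissibility, the
`T`-stable subspace `∑_{f ∈ Hom_K(τ, V)} f(τ)` is finite-dimensional and nonzero; by
irreducibility the eigenspace is all of `V`. The scalars assemble to an `ℝ`-algebra map since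
`ℂ → End V` is injective (`V ≠ 0`). [cite: WallachRRG1, Lemma 3.3.2] [cite: KnappVogan1995, Prop. 4.87 and §IV.8] [cite: BorelWallach2000, I.2.2] -/
theorem exists_hasInfinitesimalCharacter_of_irreducible_admissible_holds :
    exists_hasInfinitesimalCharacter_of_irreducible_admissible G := by
  intro _ _ V _ _ ρK ρ𝔤 hV hirr hadm hZK
  obtain ⟨hnt, hsub⟩ := hirr
  -- Step 1: every `z ∈ Z(𝔤)` acts by a scalar.
  have key : ∀ z : centerU G, ∃ c : ℂ,
      envelopingAction ρ𝔤 (z : UniversalEnvelopingAlgebra ℝ G.lie) =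
        algebraMap ℂ (Module.End ℂ V) c := by
    intro z
    set T := envelopingAction ρ𝔤 (z : UniversalEnvelopingAlgebra ℝ G.lie) with hT
    have hTK : ∀ k : G.maximalCompact, ρK k ∘ₗ T = T ∘ₗ ρK k := fun k => hZK k z
    -- a nonzero finite-dimensional `K`-stable subspace (by `K`-finiteness)
    obtain ⟨v, hv⟩ := exists_ne (0 : V)
    let F : Submodule ℂ V := Submodule.span ℂ (Set.range fun k : G.maximalCompact ↦ ρK k v)
    haveI : FiniteDimensional ℂ F := hV.kFinite v
    have hFK : ∀ k, ∀ w ∈ F, ρK k w ∈ F := by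
      intro k w hw
      have hle : F.map (ρK k) ≤ F := by
        rw [Submodule.map_span, Submodule.span_le]
        rintro _ ⟨_, ⟨k', rfl⟩, rfl⟩
        exact Submodule.subset_span ⟨k * k', by simp [map_mul]⟩
      exact hle (Submodule.mem_map_of_mem hw)
    have hvF : v ∈ F := Submodule.subset_span ⟨1, by simp⟩
    have hFne : F ≠ ⊥ := fun h => hv ((Submodule.eq_bot_iff F).mp h v hvF)
    -- a minimal nonzero `K`-stable subspace `W₀ ≤ F`: an irreducible `K`-type
    obtain ⟨W₀, hW₀F, hW₀ne, hW₀K, hW₀min⟩ := exists_minimal_stable_submodule ρK F hFne hFK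
    haveI : FiniteDimensional ℂ W₀ := Submodule.finiteDimensional_of_le hW₀F
    haveI : Nontrivial W₀ := Submodule.nontrivial_iff_ne_bot.mpr hW₀ne
    -- transport the `K`-action on `W₀` to `Fin d → ℂ : Type` (H9: `IsAdmissibleGK` has `W : Type`)
    let W₀r : Subrepresentation ρK := ⟨W₀, fun k v hv => hW₀K k v hv⟩
    let e : W₀ ≃ₗ[ℂ] (Fin (Module.finrank ℂ W₀) → ℂ) := (Module.finBasis ℂ W₀).equivFun
    let τ : Representation ℂ G.maximalCompact (Fin (Module.finrank ℂ W₀) → ℂ) :=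
      e.conjRingEquiv.toMonoidHom.comp W₀r.toRepresentation
    have hτ : ∀ k y, τ k y = e (W₀r.toRepresentation k (e.symm y)) := fun k y => rfl
    have hτ' : ∀ (k) (w : W₀), ((W₀r.toRepresentation k w : W₀) : V) = ρK k w := fun k w => rfl
    let j : τ.IntertwiningMap ρK :=
      ⟨W₀.subtype ∘ₗ e.symm.toLinearMap, fun k => LinearMap.ext fun y => by simp [hτ, hτ']⟩
    have hjapply : ∀ y, j y = ((e.symm y : W₀) : V) := fun y => rfl
    have hjinj : Function.Injective j := fun a b h => e.symm.injective (Subtype.ext h)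
    have hjrange : LinearMap.range j.toLinearMap = W₀ := by
      change LinearMap.range (W₀.subtype ∘ₗ e.symm.toLinearMap) = W₀
      rw [LinearMap.range_comp, LinearEquiv.range, Submodule.map_top, Submodule.range_subtype]
    haveI : Nontrivial (Fin (Module.finrank ℂ W₀) → ℂ) := e.injective.nontrivial
    have hτirr : τ.IsIrreducible :=
      isIrreducible_of_intertwiningMap_injective ρK j hjinj (by
        rw [hjrange]
        exact fun U hUK hUle => hW₀min U hUK hUle)
    -- admissibility: `Hom_K(τ, V)` is finite-dimensional
    haveI : FiniteDimensional ℂ (τ.IntertwiningMap ρK) := hadm _ τ hτirr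
    have hj0 : j ≠ 0 := by
      obtain ⟨b, hb, hb0⟩ := Submodule.exists_mem_ne_zero_of_ne_bot hW₀ne
      intro h
      have : j (e ⟨b, hb⟩) = b := by rw [hjapply, LinearEquiv.symm_apply_apply]
      rw [h] at this
      exact hb0 (by simpa using this.symm)
    -- hence `T` has an eigenvalue, whose eigenspace is a nonzero `(𝔤, K)`-submodule, so `= ⊤`
    obtain ⟨c, hc⟩ := exists_hasEigenvalue_of_intertwiningMap ρK j hj0 T hTK
    rcases hsub _ (isGKSubmodule_eigenspace_envelopingAction ρK ρ𝔤 z (fun k => hZK k z) c)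
      with h | h
    · exact absurd h (Module.End.hasEigenvalue_iff.mp hc)
    · refine ⟨c, LinearMap.ext fun w => ?_⟩
      have hw : w ∈ T.eigenspace c := h ▸ Submodule.mem_top
      rw [Module.End.mem_eigenspace_iff] at hw
      rw [hw, Module.algebraMap_end_apply]
  -- Step 2: the scalars form an `ℝ`-algebra homomorphism `Z(𝔤) →ₐ[ℝ] ℂ`.
  choose θ hθ using key
  have inj : Function.Injective (algebraMap ℂ (Module.End ℂ V)) :=
    (algebraMap ℂ (Module.End ℂ V)).injective
  refine
    ⟨{ toFun := θ
       map_one' := inj (by simp only [← hθ, OneMemClass.coe_one, map_one])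
       map_mul' := fun x y => inj (by simp only [← hθ, MulMemClass.coe_mul, map_mul])
       map_zero' := inj (by simp only [← hθ, ZeroMemClass.coe_zero, map_zero])
       map_add' := fun x y => inj (by simp only [← hθ, AddMemClass.coe_add, map_add])
       commutes' := fun r => inj ?_ }, fun z => hθ z⟩
  rw [← hθ, Subalgebra.coe_algebraMap, AlgHom.commutes]
  exact IsScalarTower.algebraMap_apply ℝ ℂ (Module.End ℂ V) r

end DixmierSchur

/-! ## The Harish-Chandra module is a `(𝔤, K)`-module -/

section HarishChandraModule

/-- A curve in a subspace `p ≤ F` of a complex normed space which is differentiable as an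
`F`-valued curve, with derivative in `p`, is differentiable as a `p`-valued curve with the same
derivative (the inclusion `p ↪ F` is an isometry). Wallach, §1.6.1 (context). [folklore] -/
theorem hasDerivAt_of_coe {F : Type*} [NormedAddCommGroup F] [NormedSpace ℂ F]
    {p : Submodule ℂ F} {f : ℝ → p} {f' : p} {x : ℝ}
    (h : HasDerivAt (fun t ↦ (f t : F)) (f' : F) x) : HasDerivAt f f' x := by
  rw [hasDerivAt_iff_isLittleO, ← Asymptotics.isLittleO_norm_left] at h ⊢
  simpa only [Submodule.coe_norm, Submodule.coe_sub, Submodule.coe_smul_of_tower] using h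

variable {A : Type*} [NormedCommRing A] [NormedAlgebra ℝ A] [NormedAlgebra ℚ A] [CompleteSpace A]
  [StarRing A] {N : Type*} [Fintype N] [DecidableEq N] (G : RealMatrixGroup A N)

variable {H : Type*} [NormedAddCommGroup H] [NormedSpace ℂ H]
  (π : ContRepresentation ℂ G.carrier H)

/-- **The Harish-Chandra module of a strongly continuous Banach representation is a
`(𝔤, K)`-module** (discharge of the named fact `isGKModule_harishChandra`): the smooth `K`-finite
vectors `V₀ = H^∞ ∩ H_K`, with `K` acting through `π` and `𝔤` through the derivative of `π`,
satisfy the `(𝔤, K)`-module axioms `IsGKModule` — every vector is `K`-finite, `K` acts (weakly)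
continuously, `ρK k ∘ ρ𝔤 X ∘ ρK k⁻¹ = ρ𝔤 (Ad k X)`, and the weak derivative of `ρK` along `X ∈ 𝔨`
is `ρ𝔤 X`.  Borel–Wallach, Ch. 0, 2.6 ("Let `(π, V) ∈ 𝒞_G`. Then `V₀` is a `(𝔤, K)`-module",
`V₀ = V^∞ ∩ V_(K)` as in 2.4, axioms 1), 2) of 2.5); Knapp–Vogan, Introduction §1 (the underlying
`(𝔤, K)` module `C^∞(V)_K`) with the axioms (i)–(iii) of (1.86) and `K`-finiteness (1.17);
Wallach, Lemma 3.3.3 and §3.3.4.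
[cite: BorelWallach2000, Ch. 0 §2.6 (with §2.4, §2.5)]
[cite: KnappVogan1995, Introduction §1 and Ch. I (1.17), (1.86)]
[cite: WallachRRG1, Lemma 3.3.3 and §3.3.4] -/
theorem isGKModule_harishChandra_holds : isGKModule_harishChandra G π := by
  intro _ _ _ hπ V₀ ρK hρK ρ𝔤 h
  -- (1) `K`-finiteness inside `V₀`
  have kfin : ∀ v : V₀,
      FiniteDimensional ℂ (Submodule.span ℂ (Set.range fun k : G.maximalCompact ↦ ρK k v)) := by
    intro v
    have hv : (v : H) ∈ harishChandraSpace G π := h.1 ▸ v.2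
    haveI : FiniteDimensional ℂ (kOrbitSpan G π (v : H)) := hv.2
    have hle : (Submodule.span ℂ (Set.range fun k : G.maximalCompact ↦ ρK k v)).map V₀.subtype ≤
        kOrbitSpan G π (v : H) := by
      rw [Submodule.map_span, ← Set.range_comp]
      refine Submodule.span_mono ?_
      rintro _ ⟨k, rfl⟩
      exact ⟨k, (hρK k v).symm⟩
    haveI := Submodule.finiteDimensional_of_le hle
    exact (Submodule.equivMapOfInjective V₀.subtype V₀.injective_subtype _).symm.finiteDimensional
  -- continuity of the inclusion `K → G`
  have hincl : Continuous
      (Subgroup.inclusion G.maximalCompact_le_carrier : G.maximalCompact → G.carrier) :=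
    Topology.IsInducing.subtypeVal.continuous_iff.2
      (by simpa only [Function.comp_def, Subgroup.coe_inclusion] using continuous_subtype_val)
  refine ⟨kfin, ?_, ?_, ?_⟩
  · -- (2) weak continuity of the `K`-action
    intro v ℓ
    haveI : FiniteDimensional ℂ
        (Submodule.span ℂ (Set.range fun k : G.maximalCompact ↦ ρK k v)) := kfin v
    have hmem : ∀ k : G.maximalCompact,
        ρK k v ∈ Submodule.span ℂ (Set.range fun k : G.maximalCompact ↦ ρK k v) :=
      fun k ↦ Submodule.subset_span ⟨k, rfl⟩
    have hf : Continuous fun k : G.maximalCompact ↦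
        (⟨ρK k v, hmem k⟩ : Submodule.span ℂ (Set.range fun k : G.maximalCompact ↦ ρK k v)) := by
      rw [Topology.IsInducing.subtypeVal.continuous_iff,
        Topology.IsInducing.subtypeVal.continuous_iff]
      simp only [Function.comp_def, hρK]
      exact (hπ (v : H)).comp hincl
    exact ((ℓ ∘ₗ (Submodule.span ℂ (Set.range fun k : G.maximalCompact ↦
      ρK k v)).subtype).continuous_of_finiteDimensional).comp hf
  · -- (3) compatibility with `Ad`
    intro k X
    apply LinearMap.ext
    intro w
    apply Subtype.ext
    simp only [LinearMap.coe_comp, Function.comp_apply]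
    rw [hρK]
    have hu : ((ρK k⁻¹ w : V₀) : H) =
        π (Subgroup.inclusion G.maximalCompact_le_carrier k)⁻¹ (w : H) := by
      rw [hρK, map_inv]
    have h1 : HasDerivAt (fun t : ℝ ↦ π (Subgroup.inclusion G.maximalCompact_le_carrier k)
        (π (G.expMem (t • X)) ((ρK k⁻¹ w : V₀) : H)))
        (π (Subgroup.inclusion G.maximalCompact_le_carrier k) ((ρ𝔤 X (ρK k⁻¹ w) : V₀) : H)) 0 :=
      ((π (Subgroup.inclusion G.maximalCompact_le_carrier k)).restrictScalars ℝ).hasFDerivAt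
        |>.comp_hasDerivAt (0 : ℝ) (h.2 X (ρK k⁻¹ w))
    have h2 := h.2 (G.Ad (Subgroup.inclusion G.maximalCompact_le_carrier k) X) w
    have key : ∀ t : ℝ,
        π (G.expMem (t • G.Ad (Subgroup.inclusion G.maximalCompact_le_carrier k) X)) (w : H) =
          π (Subgroup.inclusion G.maximalCompact_le_carrier k)
            (π (G.expMem (t • X)) ((ρK k⁻¹ w : V₀) : H)) := by
      intro t
      rw [← map_smul, RealMatrixGroup.expMem_Ad, map_mul, map_mul, hu, mul_apply_eq_comp,
        mul_apply_eq_comp]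
    have h1' : HasDerivAt
        (fun t : ℝ ↦ π (G.expMem (t • G.Ad (Subgroup.inclusion G.maximalCompact_le_carrier k) X))
          (w : H))
        (π (Subgroup.inclusion G.maximalCompact_le_carrier k) ((ρ𝔤 X (ρK k⁻¹ w) : V₀) : H)) 0 :=
      h1.congr_of_eventuallyEq (Filter.Eventually.of_forall key)
    exact h1'.unique h2
  · -- (4) the weak derivative of `ρK` along `𝔨`
    intro X v ℓ
    haveI : FiniteDimensional ℂ
        (Submodule.span ℂ (Set.range fun k : G.maximalCompact ↦ ρK k v)) := kfin v
    -- notation-free abbreviations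
    obtain ⟨W, hW⟩ : ∃ W : Submodule ℂ V₀,
        W = Submodule.span ℂ (Set.range fun k : G.maximalCompact ↦ ρK k v) := ⟨_, rfl⟩
    obtain ⟨Y, hY⟩ : ∃ Y : G.lie, Y = LieSubalgebra.inclusion G.compactLie_le_lie X := ⟨_, rfl⟩
    haveI : FiniteDimensional ℂ W := hW ▸ kfin v
    have hexp : ∀ t : ℝ,
        Subgroup.inclusion G.maximalCompact_le_carrier (G.expK (t • X)) = G.expMem (t • Y) := by
      intro t
      subst hY
      rfl
    have hmemW : ∀ t : ℝ, ρK (G.expK (t • X)) v ∈ W :=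
      fun t ↦ hW ▸ Submodule.subset_span ⟨_, rfl⟩
    -- the `H`-valued curve, its derivative, and the closed subspace `W' = W ⊆ H` containing it
    have hf : HasDerivAt (fun t : ℝ ↦ π (G.expMem (t • Y)) (v : H)) ((ρ𝔤 Y v : V₀) : H) 0 :=
      h.2 Y v
    have hfW' : ∀ t : ℝ, π (G.expMem (t • Y)) (v : H) ∈ W.map V₀.subtype := fun t ↦ by
      rw [← hexp, ← hρK]
      exact Submodule.mem_map_of_mem (hmemW t)
    have hf'W' : ((ρ𝔤 Y v : V₀) : H) ∈ W.map V₀.subtype := by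
      refine (W.map V₀.subtype).closed_of_finiteDimensional.mem_of_tendsto
        (hasDerivAt_iff_tendsto_slope_zero.mp hf) (Filter.Eventually.of_forall fun t ↦ ?_)
      exact Submodule.smul_of_tower_mem _ _ (Submodule.sub_mem _ (hfW' (0 + t)) (hfW' 0))
    have hf'W : ρ𝔤 Y v ∈ W := by
      obtain ⟨w, hw, hw'⟩ := Submodule.mem_map.mp hf'W'
      obtain rfl : w = ρ𝔤 Y v := Subtype.ext hw'
      exact hw
    -- the `V₀`-valued and `W`-valued curves
    have hf₀ : HasDerivAt (fun t : ℝ ↦ ρK (G.expK (t • X)) v) (ρ𝔤 Y v) 0 := by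
      refine hasDerivAt_of_coe ?_
      simp only [hρK, hexp]
      exact hf
    have hγ : HasDerivAt (fun t : ℝ ↦ (⟨ρK (G.expK (t • X)) v, hmemW t⟩ : W)) ⟨ρ𝔤 Y v, hf'W⟩ 0 :=
      hasDerivAt_of_coe hf₀
    -- `ℓ|W` is continuous
    have hℓ := ((LinearMap.toContinuousLinearMap (ℓ ∘ₗ W.subtype)).restrictScalars ℝ).hasFDerivAt
      |>.comp_hasDerivAt (0 : ℝ) hγ
    subst hY
    exact hℓ

end HarishChandraModule

end Literature.NumberTheory.Automorphic
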